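import Literature.MathematicalPhysics.QuantumFieldTheory.Balaban1983to89.B9Eq3102QprimeCommutatorLettersCarrier
import Literature.MathematicalPhysics.QuantumFieldTheory.Balaban1983to89.B9Eq319ContourAxialGauge

/-!
# `Balaban1983to89.B9Eq387IMSLocalLetterQprime` — T. Bałaban, *Propagators for lattice gauge theories in a background field*, Commun. Math. Phys.
# **99** (1985) 389–434 [Balaban1985BackgroundPropagators] p. 408 «Σ_{□∈𝒟} h²_□ = 1», (3.87)–(3.89) p. 409, (3.102) p. 414 «O(M⁻¹), or O(M⁻²) … on a
# proper scale», (3.24) p. 394, with [Balaban1984PropagatorsI] (1.7) p. 18 (the contours) and (1.118) p. 36 (the product partition): **THE (dn) LETTER OF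
# THE IMS IDENTITIES FOR THE SCALAR GAUGE-PARAMETER AVERAGING `Q̃′(U)` (3.19) WITH ITS BLOCK-OSCILLATION LETTER PRODUCED FROM THE BOND LETTER**:
# a quadratic partition `Σ_j χ_j² = 1` with `Σ_j (χ_j(b₋) − χ_j(b₊))² ≤ Θ₂` on every bond oscillates by `≤ (d(L−1))²Θ₂` over a block (along the
# contour `Γ_{y,x}`), hence `Σ_j ‖Q̃′(χ_S^jλ)‖² ≤ ‖Q̃′λ‖² + 2M_A²(d(L−1))²Θ₂·‖λ‖²`; for the tree's `C^{1,1}` partition `B5SmoothPartition.hS` (coordinatewise: `4d(4(L−1)∕M₀)²`)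
# and at the NE9 chain's transporters `adTransportW φ U`, `U(b) ∈ U1` (`M_A = M_φM_φ′`) — the `Q′`-ANALOGUE of kernel 7's `T₃` row, i.e. the (dn) row
# an IMS localisation of `Δ′_{a′}(U) = Δ^η_U + a′Q′*Q′` (3.24) would consume (kernel 7's OWN `T₃` is the VECTOR averaging `√a·Q(U)` (3.15) on 1-forms —
# ne9-leaf-01 g82's `B9Eq387IMSAveragingLettersLattice`, W-1 journal l.50082); route R2′ STEP B8′ of the pub-balaban NE9 chain

statement-level skeleton of published theorems with citation tags; proofs where landed; nothing here is a claim about the Yang–Mills mass gap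

CITATION HEADER (lean-in-tree rule).  Audit cell `pub-balaban`, sub-cell `t4`, BINDER row NE9; filed by NE9 formalisation-swarm leaf prover 05
(`b2b-balaban-t4-ne9-formalise-leaf-05`, gen 74) as the SEQUEL of `B9Eq3102QprimeCommutatorLetters` ∕ `…Carrier` (this lineage, same generation) —
the scalar-`Q′` counterpart of ne9-leaf-01's lattice rows (`B9Eq387IMSLocalLettersLattice` §3∕§4 for `T₁ = D_U`, `T₂ = D*_U` with ne9-leaf-04 g76's
letters; `B9Eq387IMSAveragingLettersLattice` for the vector `T₃ = √a·Q(U)`), built on the kernel-9 port `B9Eq387ProductPartitionBondEnergy` (CREDIT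
t4-ne9-idea-1 g95).  LOCATED READING of record (ne9-leaf-01 g82 W-1 l.50082, concurred): kernel 7's bond-form assembly ((3.26)) does NOT contain the
scalar `Q′`; this file's rows belong to a localisation of the gauge-parameter operator `Δ′_{a′}(U)` (3.24) should the route book one (t4-ne9-idea-1 to
rule), and its §1–§2 chain∕contour lemmas are carrier-free ∕ site-level and citable by the vector rows.  The contour bookkeeping is the OWNER lineage's
`B9Eq319QprimeTorus` (`isChain_centre_cons_contour`, `getLast_centre_cons_contour`) and this lineage's `B9Eq319QprimeLipschitz.length_contour_le`; the
transport letter at the chain is this lineage's `B9Eq319ContourAxialGauge.hA_letter_AdW` (gen 73).  Sources READ in the held text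
(`paper:balaban1985-cmp99-background-propagators`): p. 408 *«We have Σ_{□∈𝒟} h²_□ = 1»*, p. 414 (3.102) and l.1–3, (3.24) p. 394; [B5′] (1.7) p. 18,
(1.118) p. 36 as quoted in the cell's `B9Eq319QprimeTorus` ∕ `B5SmoothPartition` headers.

WHY.  The parent's (dn) row for the scalar `Q̃′` displays the block-oscillation letter `Σ_j (χ_j(L·y) − χ_j(x))² ≤ Θ` (`x ∈ B(y)`), whereas the IMS porter's
currency (rows L1∕L6: ne9-leaf-04's `hχ`, ne9-leaf-01's §3) is the BOND letter `Σ_j (χ_j(b₋) − χ_j(b₊))² ≤ Θ₂`.  The block centre `L·y` is joined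
to `x ∈ B(y)` by print's contour `Γ_{y,x}` — a lattice path of `Σ_κ (x_κ mod L) ≤ d(L−1)` forward unit bonds inside the block — so the triangle
inequality in `ℓ²(J)` (Minkowski) gives `√Θ ≤ d(L−1)·√Θ₂`.  In physical units (`ηL = 1`, cubes of `M₀ = M∕η` lattice steps, `Θ₂ = 64∕M₀²`):
`(d(L−1))²Θ₂ ≤ 64d²∕M²` — print's «O(M⁻²) on a proper scale», `η`-free; for the tree's PRODUCT partition the coordinates are orthogonal in `ℓ²(J)`
(the port's subadditivity), which saves a factor `d`: `4d(4(L−1)∕M₀)² ≤ 64d∕M²`.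

WHAT IS PROVED (sorry-free; proof lane — no `def`; [folklore] finite sums; nothing of [B9] asserted).
* §1 (private helpers) `sqrt_sum_sq_sub_le_add` (Minkowski for a family of differences: `√Σ_j(a_j − c_j)² ≤ √Σ_j(a_j − b_j)² + √Σ_j(b_j − c_j)²`),
  **`sqrt_sum_sq_sub_le_of_isChain`** ∕ **`sum_sq_sub_le_of_isChain`** (along a chain of `n` steps each costing `≤ Θ₂`: the endpoints differ by
  `≤ n²Θ₂`).
* §2 **`sum_sq_centre_sub_le_of_bond`** — ON THE TORUS `TSite d (L·m)`: a bond letter `Σ_j (χ_j(b₋) − χ_j(b₊))² ≤ Θ₂` gives the block-oscillation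
  letter `Σ_j (χ_j(centre y) − χ_j(x))² ≤ (d(L−1))²·Θ₂` for `x ∈ B(y)` (the contour of (3.19) as the path).
* §3 **`sum_norm_sq_T_localised_le_of_bond(_diagonal)`** — the parent's (dn) row for the scalar `Q̃′` with `Θ := (d(L−1))²Θ₂`:
  `Σ_j ‖T(χ_S^jλ)‖² ≤ ‖Tλ‖² + 2M_A²(d(L−1))²Θ₂·c₁(c₀L^d)⁻¹·‖λ‖²` (`= … ·1` at `c₁ = L^d c₀`).
* §4 THE TREE's PARTITION `B5SmoothPartition.hS (L·m) M₀` (`1 ≤ M₀`, `M₀ ∣ L·m_i`, `2M₀ ≤ L·m_i`): `sum_hS_bond_sq_le_fineP` (`Θ₂ = 64∕M₀²` on the fine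
  torus — the kernel-9 port BY NAME), `sum_gS_sub_sq_le_circAbs` (the 1-D letter `4(4r∕M₀)²` at circular offset `r`), **`sum_hS_centre_sub_sq_le`** (the block
  oscillation COORDINATEWISE: `Σ_z (hS_z(L·y) − hS_z(x))² ≤ 4d(4(L−1)∕M₀)²` — the port's subadditivity (6a′) and per coordinate the offset `x_μ mod L ≤ L−1`;
  a factor `d` below the chained bound of §2), **`sum_norm_sq_T_localised_le_smooth_diagonal`** (`Σ_z ‖T(χ_S^zλ)‖² ≤ ‖Tλ‖² + 2M_A²·4d(4(L−1)∕M₀)²·‖λ‖²`).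
* §5 AT THE CHAIN: **`sum_norm_sq_Qtilde_localised_le_smooth_diagonal`** — `T := (WL2.linearEquiv ℂ ℂ c₁)⁻¹ ∘ QprimeW L m φ U` as a CLM (its action
  hypothesis by `rfl`), `U(b) ∈ U1` on every bond ⇒ `M_A = M_φM_φ′` (`hA_letter_AdW`):
  `Σ_z ‖Q̃′(U)(χ_S^zλ)‖² ≤ ‖Q̃′(U)λ‖² + 2(M_φM_φ′)²·4d(4(L−1)∕M₀)²·‖λ‖²` at `c₁ = L^d c₀` — NO window in `U`, no volume, no count of the family.
HONEST SCOPE.  One (dn) row for the scalar `Q̃′` with its letters produced; NOT kernel 7's `T₃` (vector `Q(U)`, ne9-leaf-01 g82); the cutoff CLMs `χ_S^z`, `χ_G^z` stay HYPOTHESISED (existence: ne9-leaf-01's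
`exists_pointwise_clm_family`); the weight `√a′` of `Δ′_{a′}`'s averaging member multiplies the constant by `a′` (words); the gradient member `D_U`'s scalar (dn) row, any strong
local coercivity and the choice of `M₀` are NOT here; ONE operator's letters, NOT NE9 (cell pub-balaban: NE9 NOT PRINTED ∕ NOT PROVED;
«NE9 ⇐ the named binders»; spine PROVED 0∕9; rung (B)+1 on a finite T⁴ — NOT infinite volume, NOT mass gap, NOT Clay; HONEST DEPENDENCY: continuum YM on T⁴ ⇐
BetaPertH ∧ nine spine estimates (0/9 proved); BetaPertH ⇐ (D1) ∧ (D4) ∧ CAP+tail; G-an2-4 gates asym, D1 and NE2/3/4).  NEW file importing the parent and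
this lineage's `B9Eq319ContourAxialGauge`; nothing modified.  Net new unproved facts: 0.
-/

noncomputable section

open scoped InnerProductSpace
open Finset

namespace Literature.MathematicalPhysics.QuantumFieldTheory.Balaban1983to89.B9Eq387IMSLocalLetterQprime

open B4Sect5Torus (TSite)
open B9SectCLatticeCarrier (Bond bpos btgt shift)
open B9Eq311L2Pairing (WL2)
open B11Eq103H1Complex (SiteL2K)
open B9Eq323Ker (pathTr)
open B9Eq319QprimeTorus (fineP centre blockCoord contour stepTransport QprimeLin mem_blockOf_iff isChain_centre_cons_contour
  getLast_centre_cons_contour)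
open B9Eq319QprimeLipschitz (length_contour_le)
open B9Eq3102QprimeCommutatorLettersCarrier (sum_norm_sq_T_localised_le)

/-! ## §1 Minkowski for a family of differences, and the cost of a chain -/

section Chain

variable {X J : Type*} (s : Finset J) (χ : J → X → ℝ)

/-- **MINKOWSKI FOR A FAMILY OF DIFFERENCES**: `√Σ_j (χ_j(a) − χ_j(c))² ≤ √Σ_j (χ_j(a) − χ_j(b))² + √Σ_j (χ_j(b) − χ_j(c))²` (Cauchy–Schwarz for finite
sums). [folklore] -/
private theorem sqrt_sum_sq_sub_le_add (a b c : X) :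
    Real.sqrt (∑ j ∈ s, (χ j a - χ j c) ^ 2) ≤
      Real.sqrt (∑ j ∈ s, (χ j a - χ j b) ^ 2) + Real.sqrt (∑ j ∈ s, (χ j b - χ j c) ^ 2) := by
  set A : ℝ := ∑ j ∈ s, (χ j a - χ j b) ^ 2 with hA
  set B : ℝ := ∑ j ∈ s, (χ j b - χ j c) ^ 2 with hB
  have hA0 : 0 ≤ A := sum_nonneg fun _ _ => sq_nonneg _
  have hB0 : 0 ≤ B := sum_nonneg fun _ _ => sq_nonneg _
  have hcs : (∑ j ∈ s, (χ j a - χ j b) * (χ j b - χ j c)) ^ 2 ≤ A * B := sum_mul_sq_le_sq_mul_sq s _ _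
  have hcross : ∑ j ∈ s, (χ j a - χ j b) * (χ j b - χ j c) ≤ Real.sqrt A * Real.sqrt B :=
    (le_abs_self _).trans ((Real.abs_le_sqrt hcs).trans_eq (Real.sqrt_mul hA0 B))
  have hexp : ∑ j ∈ s, (χ j a - χ j c) ^ 2 = A + 2 * ∑ j ∈ s, (χ j a - χ j b) * (χ j b - χ j c) + B := by
    rw [hA, hB, mul_sum, ← sum_add_distrib, ← sum_add_distrib]
    exact sum_congr rfl fun j _ => by ring
  have hR0 : 0 ≤ Real.sqrt A + Real.sqrt B := add_nonneg (Real.sqrt_nonneg _) (Real.sqrt_nonneg _)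
  refine Real.sqrt_le_iff.2 ⟨hR0, ?_⟩
  rw [hexp, add_sq, Real.sq_sqrt hA0, Real.sq_sqrt hB0]
  linarith

variable {step : X → X → Prop} {Θ₂ : ℝ} (hΘ₂ : 0 ≤ Θ₂) (hstep : ∀ a b, step a b → ∑ j ∈ s, (χ j a - χ j b) ^ 2 ≤ Θ₂)

include hstep in
/-- **ALONG A CHAIN OF `n` STEPS EACH COSTING `≤ Θ₂` THE ENDPOINTS DIFFER BY `≤ n√Θ₂` IN `ℓ²(J)`**: for `IsChain step (u :: p)`,
`√Σ_j (χ_j(u) − χ_j(last))² ≤ |p|·√Θ₂`. [folklore] -/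
private theorem sqrt_sum_sq_sub_le_of_isChain : ∀ (p : List X) (u : X), List.IsChain step (u :: p) →
    Real.sqrt (∑ j ∈ s, (χ j u - χ j ((u :: p).getLast (List.cons_ne_nil u p))) ^ 2) ≤ p.length * Real.sqrt Θ₂
  | [], u, _ => by simp
  | b :: rest, u, h => by
    have hub : step u b := (List.isChain_cons_cons.1 h).1
    have hrest : List.IsChain step (b :: rest) := (List.isChain_cons_cons.1 h).2
    have ih := sqrt_sum_sq_sub_le_of_isChain rest b hrest
    have h1 : Real.sqrt (∑ j ∈ s, (χ j u - χ j b) ^ 2) ≤ Real.sqrt Θ₂ := Real.sqrt_le_sqrt (hstep u b hub)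
    rw [List.getLast_cons_cons, List.length_cons, Nat.cast_succ]
    calc _ ≤ Real.sqrt (∑ j ∈ s, (χ j u - χ j b) ^ 2) +
          Real.sqrt (∑ j ∈ s, (χ j b - χ j ((b :: rest).getLast (List.cons_ne_nil b rest))) ^ 2) := sqrt_sum_sq_sub_le_add s χ _ _ _
      _ ≤ Real.sqrt Θ₂ + rest.length * Real.sqrt Θ₂ := add_le_add h1 ih
      _ = (rest.length + 1) * Real.sqrt Θ₂ := by ring

include hΘ₂ hstep in
/-- **… SQUARED**: `Σ_j (χ_j(u) − χ_j(last))² ≤ |p|²·Θ₂`. [folklore] -/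
private theorem sum_sq_sub_le_of_isChain (p : List X) (u : X) (h : List.IsChain step (u :: p)) :
    ∑ j ∈ s, (χ j u - χ j ((u :: p).getLast (List.cons_ne_nil u p))) ^ 2 ≤ (p.length : ℝ) ^ 2 * Θ₂ := by
  have h1 := sqrt_sum_sq_sub_le_of_isChain s χ hstep p u h
  have h0 : 0 ≤ ∑ j ∈ s, (χ j u - χ j ((u :: p).getLast (List.cons_ne_nil u p))) ^ 2 := sum_nonneg fun _ _ => sq_nonneg _
  have h2 := pow_le_pow_left₀ (Real.sqrt_nonneg _) h1 2
  rwa [Real.sq_sqrt h0, mul_pow, Real.sq_sqrt hΘ₂] at h2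

end Chain

/-! ## §2 On the torus: the bond letter gives the block-oscillation letter along the contour of (3.19) -/

section Block

variable {d : ℕ} (L : ℕ) [NeZero L] (m : Fin d → ℕ) {J : Type*} (s : Finset J) (χ : J → TSite d (fineP L m) → ℝ) {Θ₂ : ℝ} (hΘ₂ : 0 ≤ Θ₂)
  (hχ2 : ∀ b : Bond d (fineP L m), ∑ j ∈ s, (χ j (bpos b) - χ j (btgt b)) ^ 2 ≤ Θ₂)

include hΘ₂ hχ2 in
/-- **THE BLOCK-OSCILLATION LETTER FROM THE BOND LETTER**: if `Σ_j (χ_j(b₋) − χ_j(b₊))² ≤ Θ₂` on every bond of the fine torus then for `x ∈ B(y)`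
`Σ_j (χ_j(L·y) − χ_j(x))² ≤ (d(L−1))²·Θ₂` — the block centre is joined to `x` by the contour `Γ_{y,x}`, a chain of `≤ d(L−1)` forward unit bonds
([B5′] (1.7); `isChain_centre_cons_contour`, `length_contour_le`). [folklore] [cite: Balaban1984PropagatorsI, (1.7) p.18; Balaban1985BackgroundPropagators, p.408, p.414] -/
theorem sum_sq_centre_sub_le_of_bond (y : TSite d m) (x : TSite d (fineP L m)) (hx : x ∈ B9Eq319QprimeTorus.blockOf L m y) :
    ∑ j ∈ s, (χ j (centre L m y) - χ j x) ^ 2 ≤ ((d : ℝ) * ((L : ℝ) - 1)) ^ 2 * Θ₂ := by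
  have hy : blockCoord L m x = y := (mem_blockOf_iff L m y x).1 hx
  have hstep : ∀ a b : TSite d (fineP L m), (∃ μ : Fin d, b = shift μ a) → ∑ j ∈ s, (χ j a - χ j b) ^ 2 ≤ Θ₂ := by
    rintro a b ⟨μ, rfl⟩
    exact hχ2 (a, μ)
  have hchain := isChain_centre_cons_contour L m x
  have h := sum_sq_sub_le_of_isChain s χ hΘ₂ hstep (contour L m x) (centre L m (blockCoord L m x)) hchain
  rw [getLast_centre_cons_contour L m x, hy] at h
  have hlen : ((contour L m x).length : ℝ) ≤ (d : ℝ) * ((L : ℝ) - 1) := by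
    have h1 := length_contour_le L m x
    have hL1 : 1 ≤ L := NeZero.one_le
    have h2 : (((contour L m x).length : ℕ) : ℝ) ≤ ((d * (L - 1) : ℕ) : ℝ) := by exact_mod_cast h1
    rwa [Nat.cast_mul, Nat.cast_sub hL1, Nat.cast_one] at h2
  have hlen0 : (0 : ℝ) ≤ (contour L m x).length := Nat.cast_nonneg _
  exact h.trans (mul_le_mul_of_nonneg_right (pow_le_pow_left₀ hlen0 hlen 2) hΘ₂)

end Block

/-! ## §3 The (dn) row for the scalar `Q̃′` with the block-oscillation letter PRODUCED from the bond letter -/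

section DnRow

variable {d : ℕ} (L : ℕ) [NeZero L] (m : Fin d → ℕ) {W : Type*} [NormedAddCommGroup W] [InnerProductSpace ℂ W] {c₀ c₁ : ℝ}
  [Fact (0 < c₀)] [Fact (0 < c₁)] {Rb : Bond d (fineP L m) → W →ₗ[ℂ] W} {MA : ℝ}
  (hA : ∀ (y : TSite d m), ∀ x ∈ B9Eq319QprimeTorus.blockOf L m y, ∀ v : W,
    ‖pathTr (stepTransport L m fun b => (Rb b).restrictScalars ℝ) (centre L m y :: contour L m x) v‖ ≤ MA * ‖v‖)
  (T : SiteL2K ℂ d (fineP L m) c₀ W →L[ℂ] WL2 ℂ (fun _ : TSite d m => c₁) W)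
  (hT : ∀ (f : SiteL2K ℂ d (fineP L m) c₀ W) (y : TSite d m),
    WL2.equiv ℂ (fun _ : TSite d m => c₁) W (T f) y = QprimeLin L m Rb (WL2.equiv ℂ (fun _ : TSite d (fineP L m) => c₀) W f) y)
  {J : Type*} (s : Finset J) {χ : J → TSite d (fineP L m) → ℝ} {Θ₂ : ℝ} (hχ1 : ∀ x, ∑ j ∈ s, χ j x ^ 2 = 1) (hΘ₂ : 0 ≤ Θ₂)
  (hχ2 : ∀ b : Bond d (fineP L m), ∑ j ∈ s, (χ j (bpos b) - χ j (btgt b)) ^ 2 ≤ Θ₂)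
  (χS : J → SiteL2K ℂ d (fineP L m) c₀ W →L[ℂ] SiteL2K ℂ d (fineP L m) c₀ W)
  (χG : J → WL2 ℂ (fun _ : TSite d m => c₁) W →L[ℂ] WL2 ℂ (fun _ : TSite d m => c₁) W)
  (hS : ∀ j (f : SiteL2K ℂ d (fineP L m) c₀ W) (x : TSite d (fineP L m)),
    WL2.equiv ℂ (fun _ : TSite d (fineP L m) => c₀) W (χS j f) x = (χ j x : ℂ) • WL2.equiv ℂ (fun _ : TSite d (fineP L m) => c₀) W f x)
  (hG : ∀ j (g : WL2 ℂ (fun _ : TSite d m => c₁) W) (y : TSite d m),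
    WL2.equiv ℂ (fun _ : TSite d m => c₁) W (χG j g) y = (χ j (centre L m y) : ℂ) • WL2.equiv ℂ (fun _ : TSite d m => c₁) W g y)

include hA hT hχ1 hΘ₂ hχ2 hS hG in
/-- **THE (dn) ROW FOR THE SCALAR `Q̃′` FROM THE BOND LETTER**: a quadratic partition `Σ_j χ_j(x)² = 1` on the fine torus with `Σ_j (χ_j(b₋) − χ_j(b₊))² ≤ Θ₂`
on every bond, its multipliers `χ_S^j` (fine sites) and `χ_G^j` (coarse sites, sampled at the block centre) as CLMs, a CLM `T` acting as `Q′` with contour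
transports `≤ M_A`: `Σ_j ‖T(χ_S^jλ)‖² ≤ ‖Tλ‖² + 2·M_A²·(d(L−1))²Θ₂·c₁(c₀L^d)⁻¹·‖λ‖²`. [folklore] (IMS localisation)
[cite: Balaban1985BackgroundPropagators, (3.102) p.414, p.408, (3.87)–(3.89) p.409, (3.19) p.393; Balaban1984PropagatorsI, (1.7) p.18] -/
theorem sum_norm_sq_T_localised_le_of_bond (hMA : 0 ≤ MA) (f : SiteL2K ℂ d (fineP L m) c₀ W) :
    ∑ j ∈ s, ‖T (χS j f)‖ ^ 2 ≤
      ‖T f‖ ^ 2 + 2 * (MA ^ 2 * (((d : ℝ) * ((L : ℝ) - 1)) ^ 2 * Θ₂) * (c₁ * (c₀ * (L : ℝ) ^ d)⁻¹)) * ‖f‖ ^ 2 :=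
  sum_norm_sq_T_localised_le L m hA T hT s hχ1 (fun y x hx => sum_sq_centre_sub_le_of_bond L m s χ hΘ₂ hχ2 y x hx) χS χG hS hG hMA
    (by positivity) f

include hA hT hχ1 hΘ₂ hχ2 hS hG in
/-- **… AT THE DIAGONAL `c₁ = L^d·c₀`**: `Σ_j ‖T(χ_S^jλ)‖² ≤ ‖Tλ‖² + 2M_A²(d(L−1))²Θ₂·‖λ‖²` — the (dn) step for the scalar `Q̃′` in the IMS porter's
bond-letter currency (constant `2M_A²(d(L−1))²Θ₂`; with `Θ₂ = Nℓ²η²` and `ηL ≤ 1`: `≤ 2M_A²d²·Nℓ²`, NO `η`).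
[folklore] (IMS localisation) [cite: Balaban1985BackgroundPropagators, (3.102) p.414, p.408, (3.87)–(3.89) p.409, (3.19) p.393, (3.11) p.392] -/
theorem sum_norm_sq_T_localised_le_of_bond_diagonal (hMA : 0 ≤ MA) (hc : c₁ = (L : ℝ) ^ d * c₀) (f : SiteL2K ℂ d (fineP L m) c₀ W) :
    ∑ j ∈ s, ‖T (χS j f)‖ ^ 2 ≤ ‖T f‖ ^ 2 + 2 * (MA ^ 2 * (((d : ℝ) * ((L : ℝ) - 1)) ^ 2 * Θ₂)) * ‖f‖ ^ 2 := by
  have hc₀ : 0 < c₀ := Fact.out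
  have hL : (0 : ℝ) < (L : ℝ) ^ d := by
    have : (0 : ℝ) < L := by exact_mod_cast Nat.pos_of_ne_zero (NeZero.ne L)
    positivity
  have h1 : c₁ * (c₀ * (L : ℝ) ^ d)⁻¹ = 1 := by rw [hc]; field_simp
  have h := sum_norm_sq_T_localised_le_of_bond L m hA T hT s hχ1 hΘ₂ hχ2 χS χG hS hG hMA f
  rwa [h1, mul_one] at h

end DnRow

/-! ## §4 The tree's `C^{1,1}` partition `B5SmoothPartition.hS` on the fine torus: the block oscillation COORDINATEWISE -/

section Smooth

open B4TorusKernel.MultiPeriod (circAbs circAbs_nonneg circAbs_le_abs)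
open B5TorusCover (nC Ctr)
open B5SmoothPartition (gS hS sum_hS_sq abs_gS_sub_le)
open B9Eq387ProductPartitionBondEnergy (sum_hS_sub_sq_le_of_neighbour sum_hS_sub_sq_le_sum exists_support_gS_pair sum_sub_sq_le_card_mul_sq)
open B9Eq387IMSLocalLettersLattice (circAbs_bond_le_one)
open B9Eq319QprimeTorus (offset offset_lt div_add_offset)
open B9Eq3102QprimeCommutatorLettersCarrier (sum_norm_sq_T_localised_le_diagonal)

variable {d : ℕ} (L : ℕ) [NeZero L] (m : Fin d → ℕ) {M₀ : ℕ} (hM : 1 ≤ M₀) (hdiv : ∀ i, M₀ ∣ fineP L m i) (h2N : ∀ i, 2 * M₀ ≤ fineP L m i)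

include hM hdiv h2N in
omit [NeZero L] in
/-- **THE TREE's PARTITION HAS BOND ENERGY `≤ 64∕M₀²` ON EVERY BOND OF THE FINE TORUS** (ne9-leaf-01's kernel-9 port
`B9Eq387ProductPartitionBondEnergy.sum_hS_sub_sq_le_of_neighbour` at the pair `(b₋, b₊)`, `circAbs_bond_le_one`) — the `Θ₂` of §3 for `hS`.
[cite: Balaban1984PropagatorsI, (1.118) p.36; Balaban1985BackgroundPropagators, p.408] -/
theorem sum_hS_bond_sq_le_fineP (b : Bond d (fineP L m)) :
    ∑ z : Ctr (fineP L m) M₀, (hS (fineP L m) M₀ z (bpos b) - hS (fineP L m) M₀ z (btgt b)) ^ 2 ≤ 64 / (M₀ : ℝ) ^ 2 := by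
  have hP : 1 ≤ fineP L m b.2 := by have := h2N b.2; omega
  exact sum_hS_sub_sq_le_of_neighbour hM hdiv h2N (bpos b) (btgt b) b.2 (fun i hi => B9SectCLatticeCarrier.shift_apply_ne hi b.1)
    (circAbs_bond_le_one b.2 hP b.1)

omit [NeZero L] in
/-- **THE ONE-DIMENSIONAL LETTER AT CIRCULAR OFFSET `r`**: `Σ_k (gS_k(t) − gS_k(t′))² ≤ 4·(4r∕M₀)²`, `r = circAbs(t − t′)` — at most four profiles see the
pair (`exists_support_gS_pair`), each `4∕M₀`-Lipschitz in the circular distance (`abs_gS_sub_le`); the per-coordinate content of the port's (6c).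
[cite: Balaban1984PropagatorsI, (1.118) p.36] -/
theorem sum_gS_sub_sq_le_circAbs {N M₀ : ℕ} (hM : 1 ≤ M₀) (hdiv : M₀ ∣ N) (h2N : 2 * M₀ ≤ N) (t t' : Fin N) :
    ∑ k : Fin (nC N M₀), (gS N M₀ k t - gS N M₀ k t') ^ 2 ≤ 4 * (4 / (M₀ : ℝ) * (circAbs N ((t.val : ℤ) - (t'.val : ℤ)) : ℝ)) ^ 2 := by
  classical
  have hN : 1 ≤ N := by omega
  obtain ⟨S, hS4, hS0⟩ := exists_support_gS_pair hM hdiv h2N t t'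
  calc ∑ k, (gS N M₀ k t - gS N M₀ k t') ^ 2
      ≤ S.card * (4 / (M₀ : ℝ) * (circAbs N ((t.val : ℤ) - (t'.val : ℤ)) : ℝ)) ^ 2 :=
        sum_sub_sq_le_card_mul_sq _ _ (fun k => abs_gS_sub_le hN hM k t t') S hS0
    _ ≤ 4 * (4 / (M₀ : ℝ) * (circAbs N ((t.val : ℤ) - (t'.val : ℤ)) : ℝ)) ^ 2 := by
        have h4 : (S.card : ℝ) ≤ 4 := by exact_mod_cast hS4
        exact mul_le_mul_of_nonneg_right h4 (sq_nonneg _)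

include hM hdiv h2N in
/-- **THE BLOCK OSCILLATION OF THE TREE's PARTITION, COORDINATEWISE**: for `x ∈ B(y)` on the fine torus `TSite d (L·m)`,
`Σ_z (hS_z(L·y) − hS_z(x))² ≤ 4d·(4(L−1)∕M₀)²` — subadditivity over the coordinates (the port's (6a′) `sum_hS_sub_sq_le_sum`) and, per coordinate, the
1-D letter at circular offset `x_μ mod L ≤ L − 1`; a factor `d` below §2's chained `(d(L−1))²·64∕M₀²` (orthogonal directions add in squares).
[folklore] [cite: Balaban1984PropagatorsI, (1.118) p.36, (1.7) p.18; Balaban1985BackgroundPropagators, p.408, p.414] -/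
theorem sum_hS_centre_sub_sq_le (y : TSite d m) (x : TSite d (fineP L m)) (hx : x ∈ B9Eq319QprimeTorus.blockOf L m y) :
    ∑ z : Ctr (fineP L m) M₀, (hS (fineP L m) M₀ z (centre L m y) - hS (fineP L m) M₀ z x) ^ 2 ≤
      4 * (d : ℝ) * (4 / (M₀ : ℝ) * ((L : ℝ) - 1)) ^ 2 := by
  have hy : blockCoord L m x = y := (mem_blockOf_iff L m y x).1 hx
  have hM0 : (0 : ℝ) ≤ 4 / (M₀ : ℝ) := by positivity
  have hμ : ∀ μ : Fin d, ∑ k : Fin (nC (fineP L m μ) M₀),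
      (gS (fineP L m μ) M₀ k (centre L m y μ) - gS (fineP L m μ) M₀ k (x μ)) ^ 2 ≤ 4 * (4 / (M₀ : ℝ) * ((L : ℝ) - 1)) ^ 2 := by
    intro μ
    have hP : 1 ≤ fineP L m μ := by have := h2N μ; omega
    refine (sum_gS_sub_sq_le_circAbs hM (hdiv μ) (h2N μ) _ _).trans ?_
    -- the centre and `x` differ by the offset `x_μ mod L ≤ L − 1` in coordinate `μ`
    have hoff : (((centre L m y μ).val : ℤ) - ((x μ).val : ℤ)) = -((offset L m x μ : ℕ) : ℤ) := by
      have h1 := div_add_offset L m x μ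
      have h2 : ((centre L m y μ).val : ℕ) = L * ((x μ : ℕ) / L) := by
        rw [B9Eq319QprimeTorus.centre_apply_val, ← hy, B9Eq319QprimeTorus.blockCoord_apply_val]
      omega
    have hle : (circAbs (fineP L m μ) (((centre L m y μ).val : ℤ) - ((x μ).val : ℤ)) : ℝ) ≤ (L : ℝ) - 1 := by
      rw [hoff]
      have h1 := circAbs_le_abs hP (-((offset L m x μ : ℕ) : ℤ))
      rw [abs_neg, Nat.abs_cast] at h1
      have h2 : offset L m x μ + 1 ≤ L := offset_lt L m x μ
      have h3 : ((offset L m x μ : ℕ) : ℝ) + 1 ≤ (L : ℝ) := by exact_mod_cast h2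
      have h4 : (circAbs (fineP L m μ) (-((offset L m x μ : ℕ) : ℤ)) : ℝ) ≤ ((offset L m x μ : ℕ) : ℝ) := by exact_mod_cast h1
      linarith
    have hc0 : (0 : ℝ) ≤ (circAbs (fineP L m μ) (((centre L m y μ).val : ℤ) - ((x μ).val : ℤ)) : ℝ) := by
      exact_mod_cast circAbs_nonneg hP _
    exact mul_le_mul_of_nonneg_left (pow_le_pow_left₀ (mul_nonneg hM0 hc0) (mul_le_mul_of_nonneg_left hle hM0) 2) (by norm_num)
  calc _ ≤ ∑ μ, ∑ k : Fin (nC (fineP L m μ) M₀), (gS (fineP L m μ) M₀ k (centre L m y μ) - gS (fineP L m μ) M₀ k (x μ)) ^ 2 :=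
        sum_hS_sub_sq_le_sum hM hdiv h2N (centre L m y) x
    _ ≤ ∑ _μ : Fin d, 4 * (4 / (M₀ : ℝ) * ((L : ℝ) - 1)) ^ 2 := sum_le_sum fun μ _ => hμ μ
    _ = 4 * (d : ℝ) * (4 / (M₀ : ℝ) * ((L : ℝ) - 1)) ^ 2 := by
        rw [sum_const, card_univ, Fintype.card_fin, nsmul_eq_mul]; ring

variable {W : Type*} [NormedAddCommGroup W] [InnerProductSpace ℂ W] {c₀ c₁ : ℝ} [Fact (0 < c₀)] [Fact (0 < c₁)]
  {Rb : Bond d (fineP L m) → W →ₗ[ℂ] W} {MA : ℝ}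
  (hA : ∀ (y : TSite d m), ∀ x ∈ B9Eq319QprimeTorus.blockOf L m y, ∀ v : W,
    ‖pathTr (stepTransport L m fun b => (Rb b).restrictScalars ℝ) (centre L m y :: contour L m x) v‖ ≤ MA * ‖v‖)
  (T : SiteL2K ℂ d (fineP L m) c₀ W →L[ℂ] WL2 ℂ (fun _ : TSite d m => c₁) W)
  (hT : ∀ (f : SiteL2K ℂ d (fineP L m) c₀ W) (y : TSite d m),
    WL2.equiv ℂ (fun _ : TSite d m => c₁) W (T f) y = QprimeLin L m Rb (WL2.equiv ℂ (fun _ : TSite d (fineP L m) => c₀) W f) y)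
  (χS : Ctr (fineP L m) M₀ → SiteL2K ℂ d (fineP L m) c₀ W →L[ℂ] SiteL2K ℂ d (fineP L m) c₀ W)
  (χG : Ctr (fineP L m) M₀ → WL2 ℂ (fun _ : TSite d m => c₁) W →L[ℂ] WL2 ℂ (fun _ : TSite d m => c₁) W)
  (hχS : ∀ z (f : SiteL2K ℂ d (fineP L m) c₀ W) (x : TSite d (fineP L m)),
    WL2.equiv ℂ (fun _ : TSite d (fineP L m) => c₀) W (χS z f) x =
      (hS (fineP L m) M₀ z x : ℂ) • WL2.equiv ℂ (fun _ : TSite d (fineP L m) => c₀) W f x)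
  (hχG : ∀ z (g : WL2 ℂ (fun _ : TSite d m => c₁) W) (y : TSite d m),
    WL2.equiv ℂ (fun _ : TSite d m => c₁) W (χG z g) y =
      (hS (fineP L m) M₀ z (centre L m y) : ℂ) • WL2.equiv ℂ (fun _ : TSite d m => c₁) W g y)

include hM hdiv h2N hA hT hχS hχG in
/-- **THE SCALAR `Q̃′` (dn) ROW FOR THE TREE's PARTITION AT THE DIAGONAL**: with `B5SmoothPartition.hS (L·m) M₀` (`1 ≤ M₀`, `M₀ ∣ L·m_i`, `2M₀ ≤ L·m_i`) sampled at one
site per cell (fine sites; block centres on the coarse torus), a CLM `T` acting as `Q′` with contour transports `≤ M_A`, at `c₁ = L^d c₀`: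
`Σ_z ‖T(χ_S^zλ)‖² ≤ ‖Tλ‖² + 2M_A²·4d(4(L−1)∕M₀)²·‖λ‖²` (`= 128·d·M_A²((L−1)∕M₀)²`) — `(L−1)∕M₀`: the averaging block against the partition cube, in lattice
units; no `η`, no volume, no count of the family. [cite: Balaban1985BackgroundPropagators, (3.102) p.414, p.408, (3.87)–(3.89) p.409; Balaban1984PropagatorsI, (1.118) p.36] -/
theorem sum_norm_sq_T_localised_le_smooth_diagonal (hMA : 0 ≤ MA) (hc : c₁ = (L : ℝ) ^ d * c₀) (f : SiteL2K ℂ d (fineP L m) c₀ W) :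
    ∑ z : Ctr (fineP L m) M₀, ‖T (χS z f)‖ ^ 2 ≤
      ‖T f‖ ^ 2 + 2 * (MA ^ 2 * (4 * (d : ℝ) * (4 / (M₀ : ℝ) * ((L : ℝ) - 1)) ^ 2)) * ‖f‖ ^ 2 :=
  sum_norm_sq_T_localised_le_diagonal L m hA T hT Finset.univ (fun x => sum_hS_sq hM hdiv h2N x)
    (fun y x hx => sum_hS_centre_sub_sq_le L m hM hdiv h2N y x hx) χS χG hχS hχG hMA (by positivity) hc f

end Smooth

/-! ## §5 At the NE9 chain: `Q̃′(U) = (WL2.linearEquiv ℂ ℂ c₁)⁻¹ ∘ QprimeW L m φ U` with `U(b) ∈ U1` — `M_A = M_φM_φ′` -/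

section Chain

open B5TorusCover (Ctr)
open B5SmoothPartition (hS)
open B7Prop1Explicit (U1)
open B9Eq310HessianOperator (adTransportW)
open B9Eq326OperatorAssembly (QprimeW)
open B9Eq319ContourAxialGauge (hA_letter_AdW)

variable {d : ℕ} (L : ℕ) [NeZero L] (m : Fin d → ℕ) [∀ i, NeZero (fineP L m i)] {M₀ : ℕ} (hM : 1 ≤ M₀) (hdiv : ∀ i, M₀ ∣ fineP L m i)
  (h2N : ∀ i, 2 * M₀ ≤ fineP L m i) {𝔸 : Type*} [NormedRing 𝔸] [NormedAlgebra ℂ 𝔸] [NormOneClass 𝔸]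
  {U : Bond d (fineP L m) → 𝔸ˣ} (hU : ∀ b, U b ∈ U1 𝔸)
  {W : Type*} [NormedAddCommGroup W] [InnerProductSpace ℂ W] [FiniteDimensional ℂ W] (φ : W ≃ₗ[ℂ] 𝔸) {Mφ Mφ' : ℝ}
  (hφ : ∀ w, ‖φ w‖ ≤ Mφ * ‖w‖) (hφ' : ∀ X, ‖φ.symm X‖ ≤ Mφ' * ‖X‖) (hMφ : 0 ≤ Mφ) (hMφ' : 0 ≤ Mφ')
  {c₀ c₁ : ℝ} [Fact (0 < c₀)] [Fact (0 < c₁)]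
  (χS : Ctr (fineP L m) M₀ → SiteL2K ℂ d (fineP L m) c₀ W →L[ℂ] SiteL2K ℂ d (fineP L m) c₀ W)
  (χG : Ctr (fineP L m) M₀ → WL2 ℂ (fun _ : TSite d m => c₁) W →L[ℂ] WL2 ℂ (fun _ : TSite d m => c₁) W)
  (hχS : ∀ z (f : SiteL2K ℂ d (fineP L m) c₀ W) (x : TSite d (fineP L m)),
    WL2.equiv ℂ (fun _ : TSite d (fineP L m) => c₀) W (χS z f) x =
      (hS (fineP L m) M₀ z x : ℂ) • WL2.equiv ℂ (fun _ : TSite d (fineP L m) => c₀) W f x)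
  (hχG : ∀ z (g : WL2 ℂ (fun _ : TSite d m => c₁) W) (y : TSite d m),
    WL2.equiv ℂ (fun _ : TSite d m => c₁) W (χG z g) y =
      (hS (fineP L m) M₀ z (centre L m y) : ℂ) • WL2.equiv ℂ (fun _ : TSite d m => c₁) W g y)

include hM hdiv h2N hU hφ hφ' hMφ hMφ' hχS hχG in
/-- **THE SCALAR `Q̃′(U)` (dn) ROW AT THE NE9 CHAIN**: for the chain's one-step gauge-parameter averaging `Q̃′(U) := (WL2.linearEquiv ℂ ℂ c₁)⁻¹ ∘ QprimeW L m φ U` on the weighted carriers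
(as a CLM; its action on the underlying functions is `QprimeLin L m (adTransportW φ U)` by `rfl`), EVERY background with `U(b) ∈ U1` (NO window), the
tree's partition sampled at one site per cell, at `c₁ = L^d c₀`:
`Σ_z ‖Q̃′(U)(χ_S^zλ)‖² ≤ ‖Q̃′(U)λ‖² + 2(M_φM_φ′)²·4d(4(L−1)∕M₀)²·‖λ‖²` — `M_A = M_φM_φ′` by `B9Eq319ContourAxialGauge.hA_letter_AdW`.
[cite: Balaban1985BackgroundPropagators, (3.19) p.393, (3.102) p.414, p.408, (3.87)–(3.89) p.409; Balaban1984PropagatorsI, (1.118) p.36] -/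
theorem sum_norm_sq_Qtilde_localised_le_smooth_diagonal (hc : c₁ = (L : ℝ) ^ d * c₀) (f : SiteL2K ℂ d (fineP L m) c₀ W) :
    ∑ z : Ctr (fineP L m) M₀,
        ‖LinearMap.toContinuousLinearMap
            ((WL2.linearEquiv ℂ ℂ (fun _ : TSite d m => c₁) (V := W)).symm.toLinearMap ∘ₗ QprimeW L m φ U (c₀ := c₀)) (χS z f)‖ ^ 2 ≤
      ‖LinearMap.toContinuousLinearMap
            ((WL2.linearEquiv ℂ ℂ (fun _ : TSite d m => c₁) (V := W)).symm.toLinearMap ∘ₗ QprimeW L m φ U (c₀ := c₀)) f‖ ^ 2 +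
        2 * ((Mφ * Mφ') ^ 2 * (4 * (d : ℝ) * (4 / (M₀ : ℝ) * ((L : ℝ) - 1)) ^ 2)) * ‖f‖ ^ 2 :=
  sum_norm_sq_T_localised_le_smooth_diagonal L m hM hdiv h2N (hA_letter_AdW L m hU φ hφ hφ' hMφ')
    (LinearMap.toContinuousLinearMap
      ((WL2.linearEquiv ℂ ℂ (fun _ : TSite d m => c₁) (V := W)).symm.toLinearMap ∘ₗ QprimeW L m φ U (c₀ := c₀)))
    (fun _ _ => rfl) χS χG hχS hχG (by positivity) hc f

end Chain

end Literature.MathematicalPhysics.QuantumFieldTheory.Balaban1983to89.B9Eq387IMSLocalLetterQprime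

end
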